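import Summits.QuantumAdvantage.QuantumAdvantage.Theorems.PhaseDialB

/-! # PhaseDialC — part 3/6 of the landing twins of NODE «PhaseDial» (decomp-qadv lens-2 g25; node file
`g25/PhaseDial.lean`, sha256 bb3dee64cd7f1b2c…; generator `g25/tree/gen_twins.py`: namespace `Theses.PhaseDial` →
`Theorems.PhaseDial`, cut at section boundaries (node lines 601–871), nothing else).
Content: §4b the COUNTING CERTIFICATE, second half (`card_bound` versus `count_lt` ⟹ `mux_gate_not_phaseForm`: a multiplexer gate is `(m, r, d)`-phase-form at the zero gauge for NO bounded type) and §5 the GENERIC INHABITANT `mqStrat` (multiplexer ⊕ one quadratic matching gate) with `mq_generic_certificate` (dense, not phase-form of any type, not table-form, not counter-form, not `𝔽₂`-low — zero gauge). -/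

set_option linter.dupNamespace false
noncomputable section
open scoped Classical

namespace Summit.QuantumAdvantage.QuantumAdvantage.Theorems.PhaseDial
open Finset
open Literature.Computability.QuantumComplexity Literature.Computability.QuantumComplexity.RingHLF
open Literature.Computability.MetaComplexity Literature.Computability.MetaComplexity.Smolensky
open Summit.QuantumAdvantage.AdviceFreeQNC0
open Summit.QuantumAdvantage.QuantumAdvantage.Theorems.AnchorDial (outB dev loss_shape_mono)
open Summit.QuantumAdvantage.QuantumAdvantage.Theorems.StabilizerDial (apIdx apStrat apStrat_mem apStrat_apply pad
  pad_mem StabFew outB_pad_pad outB_pad_congr bitP_gsum gsum gsum_mem deg_gsum dev_congr eventually_polylog winset_pad)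
open Summit.QuantumAdvantage.QuantumAdvantage.Theorems.SparsityDial (real_loss_of_frac stabFew_mono_mr one_le_logpow)
open Summit.QuantumAdvantage.QuantumAdvantage.Theorems.ResponseDial (mem_dev_apStrat dev_pad_zero
  not_polylogSparse_of_agree)
open Summit.QuantumAdvantage.QuantumAdvantage.Theorems.CounterDial (CounterForm StabCounter)
open Summit.QuantumAdvantage.QuantumAdvantage.Theorems.AbelianDial (alin TableForm StabTable AbelianLoss3
  NonAbelianLoss3 tableForm_of_counterForm stabTable_of_stabCounter nT pcell qcell pcell_injective qcell_injective
  pcell_ne_qcell qG qG_apply qStrat qStrat_agree qStrat_mem6 mem_dev_q_second indB oddZeros_indB)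
open Summit.QuantumAdvantage.QuantumAdvantage.Theorems.AbelianDial (q_in_dense_class q_not_tableForm_zero
  q_not_counterForm_zero)
open Summit.QuantumAdvantage.QuantumAdvantage.Theorems.ShadowDial (aL aW aW_pos two_mul_le_two_pow aW_mul_eight aL_lt
  aL_add_three_le acell enc dcell acell_val dcell_val acell_injective dcell_injective acell_ne_dcell dcell_ne_zero
  dcell_lt_last muxStrat muxStrat_agree muxStrat_mem_logpow mem_dev_mux_second shadow shadow_pad_zero
  q_shadow_degree_linear)
open Summit.QuantumAdvantage.QuantumAdvantage.Theorems.ScaleDial (logpow_add_logpow_le)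

variable {N : ℕ}

section Counting
variable {N : ℕ}
variable (k₀ : Fin N)
variable {m r d : ℕ}

/-- the ADDRESS PATTERN of a `d`-tuple of cells. -/
def apat (τ : Fin d → Fin N) : Fin d → Option (Fin (aL N)) := fun s => adr (τ s)

/-- the address contains the pattern: every address coordinate the tuple reads is ON. -/
def Amatch (a : Fin (aL N) → Bool) (σ : Fin d → Option (Fin (aL N))) : Prop := ∀ s j, σ s = some j → a j = true

/-- the non-address cells of the tuple are ON (a condition on the data word only: evaluated at address `0`). -/
def Dok (π : (Fin (aL N) → Bool) → Bool) (τ : Fin d → Fin N) : Prop :=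
  ∀ s, adr (τ s) = none → yin k₀ π (fun _ => false) (τ s) = true

/-- the COEFFICIENT VECTOR `C_π` of the data word `π` for the coefficient table `w`: for each address pattern `σ`, the
sum of the coefficients of the tuples of pattern `σ` whose non-address cells are ON. -/
def cof (w : (Fin d → Fin N) → Fin r → ZMod (m + 1)) (π : (Fin (aL N) → Bool) → Bool)
    (σ : Fin d → Option (Fin (aL N))) (j : Fin r) : ZMod (m + 1) :=
  ∑ τ ∈ (univ : Finset (Fin d → Fin N)).filter (fun τ => apat τ = σ), if Dok k₀ π τ then w τ j else 0

/-- evaluation of a coefficient vector at an address: `Σ_σ [a ⊇ σ] · C(σ)`. -/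
def evalC (C : (Fin d → Option (Fin (aL N))) → Fin r → ZMod (m + 1)) (a : Fin (aL N) → Bool) :
    Fin r → ZMod (m + 1) :=
  fun j => ∑ σ : Fin d → Option (Fin (aL N)), if Amatch a σ then C σ j else 0

/-- a tuple is ON at the test input iff the address contains its pattern and its non-address cells are ON. -/
theorem on_tuple_iff (hN : 16 ≤ N) (π : (Fin (aL N) → Bool) → Bool) (a : Fin (aL N) → Bool) (τ : Fin d → Fin N) :
    (∀ s, yin k₀ π a (τ s) = true) ↔ (Amatch a (apat τ) ∧ Dok k₀ π τ) := by
  constructor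
  · intro h
    refine ⟨fun s j hs => ?_, fun s hs => ?_⟩
    · rw [← yin_of_adr k₀ hN hs π a]; exact h s
    · rw [yin_of_noadr k₀ hs π (fun _ => false) a]; exact h s
  · rintro ⟨hA, hD⟩ s
    cases hs : adr (τ s) with
    | none => rw [yin_of_noadr k₀ hs π a (fun _ => false)]; exact hD s hs
    | some j => rw [yin_of_adr k₀ hN hs π a]; exact hA s j hs

/-- ★ **the readout of a test input is a bounded-degree function of the address** with coefficient vector `C_π`:
`aphase m r d w (y(π, a)) = Σ_σ [a ⊇ σ] · C_π(σ)`. -/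
theorem aphase_yin (hN : 16 ≤ N) (w : (Fin d → Fin N) → Fin r → ZMod (m + 1))
    (π : (Fin (aL N) → Bool) → Bool) (a : Fin (aL N) → Bool) :
    aphase m r d w (yin k₀ π a) = evalC (cof k₀ w π) a := by
  funext j
  unfold aphase evalC cof
  have e1 : ∀ τ : Fin d → Fin N, (if (∀ s, yin k₀ π a (τ s) = true) then w τ j else 0) =
      if Amatch a (apat τ) then (if Dok k₀ π τ then w τ j else 0) else 0 := fun τ => by
    rw [← ite_and]
    exact if_congr (on_tuple_iff k₀ hN π a τ) rfl rfl
  simp only [e1]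
  rw [← Finset.sum_fiberwise (univ : Finset (Fin d → Fin N)) (apat (N := N))
    (fun τ => if Amatch a (apat τ) then (if Dok k₀ π τ then w τ j else 0) else 0)]
  refine Finset.sum_congr rfl fun σ _ => ?_
  calc (∑ τ ∈ univ.filter (fun τ => apat τ = σ),
          (if Amatch a (apat τ) then (if Dok k₀ π τ then w τ j else 0) else 0))
      = ∑ τ ∈ univ.filter (fun τ => apat τ = σ),
          (if Amatch a σ then (if Dok k₀ π τ then w τ j else 0) else 0) :=
        Finset.sum_congr rfl fun τ hτ => by rw [(mem_filter.1 hτ).2]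
    _ = if Amatch a σ then (∑ τ ∈ univ.filter (fun τ => apat τ = σ), (if Dok k₀ π τ then w τ j else 0)) else 0 := by
        rw [Finset.sum_ite_irrel, Finset.sum_const_zero]

/-- ★ **DECODING**: under a phase form whose gate at `k₀` (off the first half-cycle) is the MULTIPLEXER gate, the data
word is read off its coefficient vector: `π(a) = G k₀ (Σ_σ [a ⊇ σ] C_π(σ))`. -/
theorem decode (hN : 16 ≤ N) (hk₀ : ¬ (1 ≤ k₀.val ∧ k₀.val < N / 2)) {P : Fin N → CubeFn (ZMod 3) N}
    (hP : P k₀ = muxStrat k₀) {w : Fin N → (Fin d → Fin N) → Fin r → ZMod (m + 1)}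
    {G : Fin N → (Fin r → ZMod (m + 1)) → Bool} (hF : PhaseForm m r d w G (pad P (fun _ => 0)))
    (π : (Fin (aL N) → Bool) → Bool) (a : Fin (aL N) → Bool) :
    π a = G k₀ (evalC (cof k₀ (w k₀) π) a) := by
  have h := hF (yin k₀ π a) (yin_odd k₀ hN π a) k₀
  rw [dev_pad_zero, mem_dev_congr_at (P := P) (Q := fun i : Fin N => muxStrat i) hP, mem_dev_mux_second _ k₀ hk₀,
    aphase_yin k₀ hN] at h
  have ha : (fun j => yin k₀ π a (acell j)) = a := funext fun j => by
    unfold yin indB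
    simp [mem_onSet_acell k₀ hN]
  have hd : yin k₀ π a (dcell k₀ a) = π a := by
    unfold yin indB
    simp [mem_onSet_dcell k₀ hN]
  rw [ha, hd] at h
  exact Bool.coe_iff_coe.mp h

/-- hence `π ↦ C_π` is INJECTIVE on data words. -/
theorem cof_injective (hN : 16 ≤ N) (hk₀ : ¬ (1 ≤ k₀.val ∧ k₀.val < N / 2)) {P : Fin N → CubeFn (ZMod 3) N}
    (hP : P k₀ = muxStrat k₀) {w : Fin N → (Fin d → Fin N) → Fin r → ZMod (m + 1)}
    {G : Fin N → (Fin r → ZMod (m + 1)) → Bool} (hF : PhaseForm m r d w G (pad P (fun _ => 0))) :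
    Function.Injective (fun π : (Fin (aL N) → Bool) → Bool => cof k₀ (w k₀) π) := by
  intro π π' h
  funext a
  rw [decode k₀ hN hk₀ hP hF π a, decode k₀ hN hk₀ hP hF π' a]
  beta_reduce at h
  rw [h]

/-- ★ **the COUNT**: a phase form `(m, r, d)` with a multiplexer gate forces `2^(2^L) ≤ ((m+1)^r)^((L+1)^d)`. -/
theorem card_bound (hN : 16 ≤ N) (hk₀ : ¬ (1 ≤ k₀.val ∧ k₀.val < N / 2)) {P : Fin N → CubeFn (ZMod 3) N}
    (hP : P k₀ = muxStrat k₀) {w : Fin N → (Fin d → Fin N) → Fin r → ZMod (m + 1)}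
    {G : Fin N → (Fin r → ZMod (m + 1)) → Bool} (hF : PhaseForm m r d w G (pad P (fun _ => 0))) :
    2 ^ 2 ^ aL N ≤ ((m + 1) ^ r) ^ (aL N + 1) ^ d := by
  have h := Fintype.card_le_of_injective _ (cof_injective k₀ hN hk₀ hP hF)
  simpa [Fintype.card_fun, Fintype.card_bool, Fintype.card_fin, Fintype.card_option, ZMod.card] using h

end Counting

/-- arithmetic: `((m+1)^r)^((L+1)^d) < 2^(2^L)` for `L = log₂ n − 3`, eventually in `n` (polylog versus `n/16`). -/
theorem count_lt (m r d : ℕ) : ∃ n₀ : ℕ, ∀ n ≥ n₀, 16 ≤ n ∧ ((m + 1) ^ r) ^ (aL n + 1) ^ d < 2 ^ 2 ^ aL n := by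
  obtain ⟨n₀, hn₀⟩ := eventually_polylog (16 * (m * r) + 1) d
  refine ⟨max n₀ 16, fun n hn => ?_⟩
  have hn16 : 16 ≤ n := le_trans (le_max_right _ _) hn
  obtain ⟨hpl, hlog⟩ := hn₀ n (le_trans (le_max_left _ _) hn)
  refine ⟨hn16, ?_⟩
  obtain ⟨h2L, h8, h16, hL3⟩ := geom hn16
  have hE : (aL n + 1) ^ d ≤ (Nat.log 2 n) ^ d := Nat.pow_le_pow_left (by unfold aL; omega) d
  have hlogpos : 1 ≤ (Nat.log 2 n) ^ d := Nat.one_le_pow _ _ (by omega)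
  have hdiv : n / 2 ≤ n := Nat.div_le_self n 2
  have h1 : 16 * (m * r * (Nat.log 2 n) ^ d) < n := by nlinarith
  have h2 : m * r * (aL n + 1) ^ d ≤ m * r * (Nat.log 2 n) ^ d := Nat.mul_le_mul_left _ hE
  have h3 : aW n = 2 ^ aL n := rfl
  have hkey : m * r * (aL n + 1) ^ d < 2 ^ aL n := by omega
  have hmr : (m + 1) ^ r ≤ 2 ^ (m * r) := by
    rw [pow_mul]
    exact Nat.pow_le_pow_left (Nat.succ_le_of_lt m.lt_two_pow_self) r
  calc ((m + 1) ^ r) ^ (aL n + 1) ^ d ≤ (2 ^ (m * r)) ^ (aL n + 1) ^ d := Nat.pow_le_pow_left hmr _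
    _ = 2 ^ (m * r * (aL n + 1) ^ d) := by rw [← pow_mul]
    _ < 2 ^ 2 ^ aL n := Nat.pow_lt_pow_right (by norm_num) hkey

/-- ★★ **THE GENERIC CERTIFICATE**: a family whose gate at some position `k₀` off the first half-cycle is the MULTIPLEXER
gate is `(m, r, d)`-phase-form at the zero gauge for NO bounded type — for every `(m, r, d)`, eventually in `n`. -/
theorem mux_gate_not_phaseForm (m r d : ℕ) : ∃ n₀ : ℕ, ∀ n ≥ n₀, ∀ k₀ : Fin n, ¬ (1 ≤ k₀.val ∧ k₀.val < n / 2) →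
    ∀ P : Fin n → CubeFn (ZMod 3) n, P k₀ = muxStrat k₀ →
      ∀ (w : Fin n → (Fin d → Fin n) → Fin r → ZMod (m + 1)) (G : Fin n → (Fin r → ZMod (m + 1)) → Bool),
        ¬ PhaseForm m r d w G (pad P (fun _ => 0)) := by
  obtain ⟨n₀, hn₀⟩ := count_lt m r d
  refine ⟨n₀, fun n hn k₀ hk₀ P hP w G hF => ?_⟩
  obtain ⟨hn16, hlt⟩ := hn₀ n hn
  exact absurd (card_bound k₀ hn16 hk₀ hP hF) (not_le.mpr hlt)

/-- in particular the multiplexer family itself (NODE «ShadowDial» §5, inside the DECIDED `𝔽₂`-low class) has no bounded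
phase type at the zero gauge. -/
theorem mux_not_phaseForm_zero (m r d : ℕ) : ∃ n₀ : ℕ, ∀ n ≥ n₀,
    ∀ (w : Fin n → (Fin d → Fin n) → Fin r → ZMod (m + 1)) (G : Fin n → (Fin r → ZMod (m + 1)) → Bool),
      ¬ PhaseForm m r d w G (pad (fun i : Fin n => muxStrat i) (fun _ => 0)) := by
  obtain ⟨n₀, hn₀⟩ := mux_gate_not_phaseForm m r d
  refine ⟨max n₀ 1, fun n hn w G => hn₀ n (le_trans (le_max_left _ _) hn) ⟨0, by omega⟩ (by simp) _ rfl w G⟩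

/-! ## §5  The GENERIC INHABITANT `mqStrat` = multiplexer ⊕ one quadratic gate: outside EVERY decided class at the zero gauge

The multiplexer family with its LAST gate replaced by the matching gate of `qStrat`: dense (agrees with `apStrat` on the
first half-cycle), degree `≤ log₂ n`, NOT `(m,r,d)`-phase-form for any type (the multiplexer gate at position `0`, §4) —
hence not table-form of any abelian type and not counter-form — and NOT cheaply `𝔽₂`-low (the quadratic gate at position
`N − 1`, NODE «ShadowDial» §4b): it inhabits the hypothesis class of the residual `NonPhaseLoss3` at the zero gauge and NO
landed loss law (counter / table / `𝔽₂`-shadow / echo / blind) applies to it as stated. -/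

/-- **`mqStrat`**: the matching gate at the last position, multiplexer gates elsewhere. -/
def mqStrat (k : Fin N) : CubeFn (ZMod 3) N := if k.val = N - 1 then qStrat k else muxStrat k

/-- on the first half-cycle `mqStrat` IS the antipodal pointer. -/
theorem mqStrat_agree (n : ℕ) (k : Fin n) (h1 : 1 ≤ k.val) (h2 : k.val < n / 2) : mqStrat k = apStrat k := by
  unfold mqStrat; rw [if_neg (by omega), muxStrat_agree k h1 h2]

/-- at position `0` (for `N ≥ 2`) the gate is the multiplexer gate. -/
theorem mqStrat_first (hN : 2 ≤ N) (k : Fin N) (hk : k.val = 0) : mqStrat k = muxStrat k := by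
  unfold mqStrat; rw [if_neg (by omega)]

/-- at the last position the gate is the matching gate. -/
theorem mqStrat_last (k : Fin N) (hk : k.val = N - 1) : mqStrat k = qStrat k := by
  unfold mqStrat; rw [if_pos hk]

/-- `mqStrat` is in the DENSE class (`c ≥ 1`): degree `≤ (log₂ n)^c`, not stabilizer-few, eventually. -/
theorem mq_in_dense_class (a c : ℕ) (hc : 1 ≤ c) :
    ∃ n₀ : ℕ, ∀ n ≥ n₀, (∀ i : Fin n, mqStrat i ∈ lowDeg (ZMod 3) n ((Nat.log 2 n) ^ c)) ∧
      ¬ StabFew ((Nat.log 2 n) ^ a) 0 (c + 1) (fun j : Fin n => mqStrat j) := by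
  obtain ⟨n₀, hn₀⟩ := not_polylogSparse_of_agree (fun n (j : Fin n) => mqStrat j)
    (fun n j h1 h2 => mqStrat_agree n j h1 h2) a (c + 1)
  refine ⟨max n₀ 64, fun n hn => ⟨fun i => ?_, hn₀ n (le_trans (le_max_left _ _) hn)⟩⟩
  have h64 : 64 ≤ n := le_trans (le_max_right _ _) hn
  unfold mqStrat
  split_ifs
  · refine lowDeg_mono ?_ (qStrat_mem6 i)
    have hL : 6 ≤ Nat.log 2 n := Nat.le_log_of_pow_le (by norm_num) (by omega)
    calc 6 ≤ Nat.log 2 n := hL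
      _ = (Nat.log 2 n) ^ 1 := (pow_one _).symm
      _ ≤ (Nat.log 2 n) ^ c := Nat.pow_le_pow_right (by omega) hc
  · exact muxStrat_mem_logpow (by omega) c hc i

/-- ★ `mqStrat` is NOT `(m, r, d)`-PHASE-FORM at the zero gauge, for EVERY bounded type, eventually in `n`. -/
theorem mq_not_phaseForm_zero (m r d : ℕ) : ∃ n₀ : ℕ, ∀ n ≥ n₀,
    ∀ (w : Fin n → (Fin d → Fin n) → Fin r → ZMod (m + 1)) (G : Fin n → (Fin r → ZMod (m + 1)) → Bool),
      ¬ PhaseForm m r d w G (pad (fun i : Fin n => mqStrat i) (fun _ => 0)) := by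
  obtain ⟨n₀, hn₀⟩ := mux_gate_not_phaseForm m r d
  refine ⟨max n₀ 2, fun n hn w G => hn₀ n (le_trans (le_max_left _ _) hn) ⟨0, by omega⟩ (by simp) _
    (mqStrat_first (le_trans (le_max_right _ _) hn) _ rfl) w G⟩

/-- hence NOT `(m, r)`-TABLE-FORM at the zero gauge for every abelian type (degree `1`) … -/
theorem mq_not_tableForm_zero (m r : ℕ) : ∃ n₀ : ℕ, ∀ n ≥ n₀,
    ∀ (v : Fin n → Fin n → Fin r → ZMod (m + 1)) (G : Fin n → (Fin r → ZMod (m + 1)) → Bool),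
      ¬ TableForm m r v G (pad (fun i : Fin n => mqStrat i) (fun _ => 0)) := by
  obtain ⟨n₀, hn₀⟩ := mq_not_phaseForm_zero m r 1
  exact ⟨n₀, fun n hn v G hT => hn₀ n hn _ _ (phaseForm_of_tableForm hT)⟩

/-- … and NOT COUNTER-FORM at the zero gauge (type `(2, 1)`). -/
theorem mq_not_counterForm_zero : ∃ n₀ : ℕ, ∀ n ≥ n₀, ∀ (a : Fin n → Fin n → ZMod 3) (A : Fin n → Finset (ZMod 3)),
    ¬ CounterForm a A (pad (fun i : Fin n => mqStrat i) (fun _ => 0)) := by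
  obtain ⟨n₀, hn₀⟩ := mq_not_tableForm_zero 2 1
  exact ⟨n₀, fun n hn a A hC => hn₀ n hn _ _ (tableForm_of_counterForm hC)⟩

/-- the Boolean shadow of a position depends only on that position's polynomial. -/
theorem shadow_congr_at {P Q : Fin N → CubeFn (ZMod 3) N} {k : Fin N} (h : P k = Q k) :
    Summit.QuantumAdvantage.QuantumAdvantage.Theorems.ShadowDial.shadow P k =
      Summit.QuantumAdvantage.QuantumAdvantage.Theorems.ShadowDial.shadow Q k := by
  unfold Summit.QuantumAdvantage.QuantumAdvantage.Theorems.ShadowDial.shadow; rw [h]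

/-- ★ `mqStrat` is NOT cheaply `𝔽₂`-LOW at the zero gauge, for EVERY shadow exponent `e'` (its last gate is the matching
gate; NODE «ShadowDial»'s ternary certificate `q_shadow_degree_linear` transferred position-wise). -/
theorem mq_not_F2low_zero (e' : ℕ) : ∃ n₀ : ℕ, ∀ n ≥ n₀,
    ¬ ∀ k : Fin n, shadow (pad (fun i : Fin n => mqStrat i) (fun _ => 0)) k ∈ lowDeg (ZMod 2) n ((Nat.log 2 n) ^ e') := by
  refine ⟨max (2 ^ (2 ^ (e' + (e' + 1) + 2))) 16, fun n hn h => ?_⟩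
  have hn16 : 16 ≤ n := le_trans (le_max_right _ _) hn
  have hgrow : (Nat.log 2 n) ^ e' + (Nat.log 2 n) ^ (e' + 1) ≤ n - 1 :=
    logpow_add_logpow_le (A := e') (B := e' + 1) (n := n) (le_trans (le_max_left _ _) hn)
  have hL : 4 ≤ Nat.log 2 n := Nat.le_log_of_pow_le (by norm_num) (by omega)
  have h4 : 4 * (Nat.log 2 n) ^ e' ≤ (Nat.log 2 n) ^ (e' + 1) := by
    rw [pow_succ, mul_comm]
    exact Nat.mul_le_mul_left _ hL
  have hlt : (Nat.log 2 n) ^ e' ≤ (n - 1) / 2 - 3 := by omega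
  have hN9 : 9 ≤ n := by omega
  have hk := h ⟨n - 1, by omega⟩
  rw [shadow_pad_zero, shadow_congr_at (P := fun i : Fin n => mqStrat i) (Q := fun i : Fin n => qStrat i)
    (mqStrat_last _ rfl), ← shadow_pad_zero] at hk
  exact q_shadow_degree_linear hN9 (lowDeg_mono hlt hk)

/-- ★ **SUMMARY (generic side)** — for every `(m, r, d, a, e')` and `c ≥ 1`, eventually in `n`: `mqStrat` is of degree
`≤ (log₂ n)^c`, NOT stabilizer-few (dense), NOT `(m,r,d)`-phase-form, NOT `(m,r)`-table-form, NOT counter-form and NOT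
`𝔽₂`-low of degree `(log₂ n)^e'` — all at the zero gauge: it inhabits `NonPhaseLoss3`'s hypothesis class and no decided
loss law of the lineage applies to it as stated. -/
theorem mq_generic_certificate (m r d a c e' : ℕ) (hc : 1 ≤ c) : ∃ n₀ : ℕ, ∀ n ≥ n₀,
    (∀ i : Fin n, mqStrat i ∈ lowDeg (ZMod 3) n ((Nat.log 2 n) ^ c)) ∧
    ¬ StabFew ((Nat.log 2 n) ^ a) 0 (c + 1) (fun j : Fin n => mqStrat j) ∧
    (∀ (w : Fin n → (Fin d → Fin n) → Fin r → ZMod (m + 1)) (G : Fin n → (Fin r → ZMod (m + 1)) → Bool),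
      ¬ PhaseForm m r d w G (pad (fun i : Fin n => mqStrat i) (fun _ => 0))) ∧
    (∀ (v : Fin n → Fin n → Fin r → ZMod (m + 1)) (G : Fin n → (Fin r → ZMod (m + 1)) → Bool),
      ¬ TableForm m r v G (pad (fun i : Fin n => mqStrat i) (fun _ => 0))) ∧
    (∀ (b : Fin n → Fin n → ZMod 3) (A : Fin n → Finset (ZMod 3)),
      ¬ CounterForm b A (pad (fun i : Fin n => mqStrat i) (fun _ => 0))) ∧
    ¬ ∀ k : Fin n, shadow (pad (fun i : Fin n => mqStrat i) (fun _ => 0)) k ∈ lowDeg (ZMod 2) n ((Nat.log 2 n) ^ e') := by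
  obtain ⟨n₁, h₁⟩ := mq_in_dense_class a c hc
  obtain ⟨n₂, h₂⟩ := mq_not_phaseForm_zero m r d
  obtain ⟨n₃, h₃⟩ := mq_not_tableForm_zero m r
  obtain ⟨n₄, h₄⟩ := mq_not_counterForm_zero
  obtain ⟨n₅, h₅⟩ := mq_not_F2low_zero e'
  refine ⟨max (max (max n₁ n₂) (max n₃ n₄)) n₅, fun n hn => ?_⟩
  have hn₁ : n₁ ≤ n := by omega
  have hn₂ : n₂ ≤ n := by omega
  have hn₃ : n₃ ≤ n := by omega
  have hn₄ : n₄ ≤ n := by omega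
  have hn₅ : n₅ ≤ n := by omega
  exact ⟨(h₁ n hn₁).1, (h₁ n hn₁).2, h₂ n hn₂, h₃ n hn₃, h₄ n hn₄, h₅ n hn₅⟩

/-- ★ **SUMMARY (special side)** — `qStrat` inhabits `PhaseLoss3`'s hypothesis class at type `(2, 1, 2)` (zero gauge): for
every `(M, R, a, e)` and `c ≥ 1`, eventually in `n`: degree `≤ (log₂ n)^c`, dense, NOT counter-form, NOT `(M, R)`-table-form,
and `(2, 1, 2)`-PHASE-FORM (NODE «AbelianDial» §4 + `q_stabPhase`). -/
theorem q_special_certificate (M R a c e : ℕ) (hc : 1 ≤ c) : ∃ n₀ : ℕ, ∀ n ≥ n₀,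
    (∀ i : Fin n, qStrat i ∈ lowDeg (ZMod 3) n ((Nat.log 2 n) ^ c)) ∧
    ¬ StabFew ((Nat.log 2 n) ^ a) 0 (c + 1) (fun j : Fin n => qStrat j) ∧
    (¬ ∃ (b : Fin n → Fin n → ZMod 3) (A : Fin n → Finset (ZMod 3)),
      CounterForm b A (pad (fun i : Fin n => qStrat i) (fun _ => 0))) ∧
    (¬ ∃ (v : Fin n → Fin n → Fin R → ZMod (M + 1)) (G : Fin n → (Fin R → ZMod (M + 1)) → Bool),
      TableForm M R v G (pad (fun i : Fin n => qStrat i) (fun _ => 0))) ∧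
    StabPhase 2 1 2 e (fun i : Fin n => qStrat i) := by
  obtain ⟨n₁, h₁⟩ := q_in_dense_class a c hc
  refine ⟨max n₁ (2 * (M + 1) ^ R + 10), fun n hn => ?_⟩
  have hn₁ : n₁ ≤ n := le_trans (le_max_left _ _) hn
  have hn₂ : 2 * (M + 1) ^ R + 10 ≤ n := le_trans (le_max_right _ _) hn
  exact ⟨(h₁ n hn₁).1, (h₁ n hn₁).2, q_not_counterForm_zero n (by omega), q_not_tableForm_zero M R n (by omega),
    q_stabPhase e⟩

end Summit.QuantumAdvantage.QuantumAdvantage.Theorems.PhaseDial
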